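import Mathlib

/-!
# The random digital shift: base-`b` digits of a uniform point, shift invariance, unbiasedness

Write `x = Σ_{k ≥ 1} ξ_k b^{-k}` for the base-`b` expansion of `x ∈ [0,1)` (digits `ξ_k ∈ {0,…,b-1}`,
the expansion with infinitely many digits `≠ b - 1`; this is Mathlib's `Real.digits x b`, and
`Real.ofDigits` is the map `(ξ_k) ↦ Σ ξ_k b^{-k}`).  The **digital shift** of `x` by `σ ∈ [0,1)` is
`x ⊕ σ = Σ_k ((ξ_k + σ_k) mod b) b^{-k}` — digit-wise addition in `ℤ/bℤ` of the two expansions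
[Lemieux 2009, §6.2.2, pp. 205–206; Dick–Pillichshammer 2014, eq. (9.22)]; on `[0,1)ˢ` it acts
coordinatewise.  It is to digital nets what the Cranley–Patterson rotation
(`Literature.Analysis.Quadrature.LatticeRules`, `integral_qmcAverage_add_eq`) is to lattice rules: a
random `σ ~ U[0,1)ˢ` makes EVERY point `x ⊕ σ` uniformly distributed on `[0,1)ˢ` [Lemieux 2009,
§6.2.3, p. 206: the digital shift "ensures that each randomized point is uniformly distributed over
`[0,1)ˢ`"], so that the digitally shifted equal-weight rule over ANY point set is an unbiased
estimator of `∫_{[0,1)ˢ} f` (the premise of the variance formula [Lemieux 2009, Prop. 6.3]).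

We formalise, for `b ≥ 1` digits (`[NeZero b]`) and `b ≥ 2` where the expansion must be faithful:

* `digitMeasure b`, `digitSeqMeasure b` — the uniform law of one digit and the product law of a digit
  sequence `ℕ → Fin b` (Mathlib's `Measure.infinitePi`);
* `map_digits_restrict_Ico` — **the digits of a uniform point are i.i.d. uniform**: the push-forward
  of Lebesgue measure on `[0,1)` under `x ↦ Real.digits x b` is `digitSeqMeasure b`; and conversely
  `map_ofDigits_digitSeqMeasure` — `Real.ofDigits` pushes `digitSeqMeasure b` forward to Lebesgue
  measure on `[0,1)` [Kallenberg2021, Lemma 3.20] (stated there for `b = 2`; the base-`b`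
  statement and proof are identical).  The proof computes the mass of the digit cylinders
  `{x ∈ [0,1) : ξ_1 … ξ_n prescribed} ⊆ [m b^{-n}, (m+1) b^{-n}]` (`≤ b^{-n}` each, `bⁿ` of them,
  total mass `1`, hence `= b^{-n}` each) and concludes with Mathlib's characterisation
  `Measure.eq_infinitePi` of the product measure by its values on boxes;
* the instance `IsAddLeftInvariant (digitSeqMeasure b)` — translation invariance of the product law
  under digit-wise addition (it is the Haar probability measure of the compact group `(ℤ/bℤ)^ℕ`);
* `digitalShift b x σ` [Lemieux2009, §6.2.2] and `measurePreserving_digitalShift` — for EVERY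
  `x : ℝ`, `σ ↦ x ⊕ σ` preserves Lebesgue measure on `[0,1)`; `digitalShiftPi`,
  `measurePreserving_digitalShiftPi` — the same on `[0,1)ˢ` (`unitCubeIco`);
  `setIntegral_comp_digitalShiftPi` — `∫_{[0,1)ˢ} f(x ⊕ σ) dσ = ∫_{[0,1)ˢ} f` ("each randomized
  point is uniformly distributed", [Lemieux2009, §6.2.3]);
* `setIntegral_digitalShiftAverage` — **unbiasedness**: for every finite nonempty point family
  `P_1, …, P_N ∈ ℝˢ` and every `f` integrable on `[0,1)ˢ`,
  `∫_{[0,1)ˢ} (1/N) Σ_i f(P_i ⊕ σ) dσ = ∫_{[0,1)ˢ} f` [Lemieux2009, §6.2.2].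

Design.  Everything is first proved on the digit space `ℕ → Fin b` with the product measure and
transported to `[0,1)` along `Real.digits` / `Real.ofDigits` (`Mathlib.Analysis.Real.OfDigits`),
which are inverse to each other on `[0,1)` (Mathlib's `Real.ofDigits_digits`).  The shift is defined
for all real `x, σ` through `Real.digits` (outside `[0,1)` the digit map is not an expansion, but the
shift-invariance statements hold verbatim for every `x`).  Deliberately NOT here: Walsh functions,
the dual net and the variance formula `Var = Σ_{0 ≠ h ∈ C⊥} |f̃(h)|²` of a digitally shifted digital
net [Lemieux 2009, Prop. 6.3; App. B, Props. B.1–B.3], linear / nested scrambling (Matoušek, Owen),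
and the preservation of the `(t,m,s)`-net property under digital shifts
[Dick–Pillichshammer 2014, §9.3.4].

## References

* C. Lemieux, *Monte Carlo and Quasi-Monte Carlo Sampling*, Springer 2009: §6.2.2 "Digital shift"
  (pp. 205–206), §6.2.3 (p. 206), Prop. 6.3 (p. 210). [Lemieux2009, §6.2.2]
* J. Dick, F. Pillichshammer, *Discrepancy theory and quasi-Monte Carlo integration*, in: A Panorama
  of Discrepancy Theory, LNM 2107, Springer 2014, §9.3.4, eq. (9.22) (randomly digitally shifted
  nets). [DickPillichshammer2014, eq. (9.22)]
* O. Kallenberg, *Foundations of Modern Probability*, 3rd ed., Springer 2021, Lemma 3.20 (a random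
  variable in `[0,1]` is `U(0,1)` iff its binary digits form a Bernoulli(1/2) sequence).
  [Kallenberg2021, Lemma 3.20]

AI-produced formalisation (H21 engines group, seat eng-quad-1, 2026-08-21); no facts, no axioms
beyond Mathlib's, no `sorry`.
-/

open MeasureTheory Set
open scoped ENNReal

noncomputable section

namespace Literature.Analysis.Quadrature

variable (b : ℕ)

/-! ### The digit space `ℕ → Fin b` and its product law -/

/-- The uniform probability law of one base-`b` digit: mass `1/b` on each of `0, …, b - 1`.
[folklore] -/
def digitMeasure : Measure (Fin b) := (b : ℝ≥0∞)⁻¹ • Measure.count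

/-- Each digit value has mass `1/b`. [folklore] -/
@[simp] private theorem digitMeasure_singleton (a : Fin b) : digitMeasure b {a} = (b : ℝ≥0∞)⁻¹ := by
  simp [digitMeasure]

/-- The uniform digit law is a probability measure (`b ≥ 1`). [folklore] -/
instance isProbabilityMeasure_digitMeasure [NeZero b] : IsProbabilityMeasure (digitMeasure b) := by
  constructor
  rw [← Finset.coe_univ, ← sum_measure_singleton]
  simp only [digitMeasure_singleton, Finset.sum_const, Finset.card_univ, Fintype.card_fin,
    nsmul_eq_mul]
  exact ENNReal.mul_inv_cancel (Nat.cast_ne_zero.mpr (NeZero.ne b)) (ENNReal.natCast_ne_top b)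

/-- The law of an i.i.d. sequence of uniform base-`b` digits: the product probability measure on the
digit space `ℕ → Fin b` (the Haar probability measure of the compact group `(ℤ/bℤ)^ℕ`).
[folklore] -/
def digitSeqMeasure [NeZero b] : Measure (ℕ → Fin b) :=
  Measure.infinitePi fun _ : ℕ => digitMeasure b

/-- The digit-sequence law is a probability measure. [folklore] -/
instance isProbabilityMeasure_digitSeqMeasure [NeZero b] :
    IsProbabilityMeasure (digitSeqMeasure b) := by
  unfold digitSeqMeasure; infer_instance

/-- The first `n` digits of a digit sequence. [folklore] -/
private def digitPrefix (n : ℕ) (d : ℕ → Fin b) : Fin n → Fin b := fun i => d i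

/-- Taking the first `n` digits is measurable. [folklore] -/
private theorem measurable_digitPrefix (n : ℕ) : Measurable (digitPrefix b n) :=
  measurable_pi_lambda _ fun i => measurable_pi_apply (i : ℕ)

/-- Extension of a finite digit string by zeros. [folklore] -/
private def prefixExtend [NeZero b] {n : ℕ} (e : Fin n → Fin b) : ℕ → Fin b :=
  fun i => if h : i < n then e ⟨i, h⟩ else 0

/-- The fibre of the prefix map over a digit string is the box prescribing the first `n` digits.
[folklore] -/
private theorem digitPrefix_preimage_singleton [NeZero b] {n : ℕ} (e : Fin n → Fin b) :
    digitPrefix b n ⁻¹' {e} =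
      Set.pi (↑(Finset.range n)) (fun i => ({prefixExtend b e i} : Set (Fin b))) := by
  ext d
  simp only [mem_preimage, mem_singleton_iff, Set.mem_pi, Finset.coe_range, mem_Iio]
  constructor
  · rintro rfl i hi
    simp [digitPrefix, prefixExtend, hi]
  · intro h
    funext i
    have := h i i.isLt
    simpa [digitPrefix, prefixExtend, i.isLt] using this

/-- Under the product law, prescribing the first `n` digits costs `b^{-n}`. [folklore] -/
private theorem digitSeqMeasure_preimage_digitPrefix [NeZero b] {n : ℕ} (e : Fin n → Fin b) :
    digitSeqMeasure b (digitPrefix b n ⁻¹' {e}) = ((b : ℝ≥0∞)⁻¹) ^ n := by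
  rw [digitPrefix_preimage_singleton, digitSeqMeasure,
    Measure.infinitePi_pi _ (fun i _ => measurableSet_singleton _)]
  simp

/-! ### Digits of a uniform point of `[0,1)` -/

/-- The digit map `x ↦ (ξ_k(x))_k` (`Real.digits`) is measurable. [folklore] -/
private theorem measurable_digits [NeZero b] : Measurable fun x : ℝ => Real.digits x b := by
  refine measurable_pi_lambda _ fun i => ?_
  have h1 : Measurable fun x : ℝ => ⌊x * (b : ℝ) ^ (i + 1)⌋₊ :=
    Nat.measurable_floor.comp (measurable_id.mul_const _)
  exact (measurable_from_top (f := fun m : ℕ => (Fin.ofNat b m : Fin b))).comp h1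

/-- Lebesgue measure restricted to `[0,1)` is a probability measure. [folklore] -/
instance isProbabilityMeasure_volume_restrict_Ico :
    IsProbabilityMeasure ((volume : Measure ℝ).restrict (Ico (0 : ℝ) 1)) :=
  ⟨by simp [Real.volume_Ico]⟩

/-- The digit cylinder `{x ∈ [0,1) : ξ_1(x) … ξ_n(x) = e}` lies in an interval of length `b^{-n}`:
if the first `n` digits of `x ∈ [0,1)` are `e` then `m b^{-n} ≤ x ≤ (m+1) b^{-n}` with
`m = Σ_{k<n} e_k b^{n-1-k} = ⌊bⁿ x⌋`. [folklore] -/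
private theorem setOf_digitPrefix_digits_subset_Icc [NeZero b] {n : ℕ} (e : Fin n → Fin b) :
    {x : ℝ | digitPrefix b n (Real.digits x b) = e} ∩ Ico (0 : ℝ) 1 ⊆
      Icc (((b : ℝ) ^ n * ∑ i ∈ Finset.range n, Real.ofDigitsTerm (prefixExtend b e) i) / (b : ℝ) ^ n)
        (((b : ℝ) ^ n * ∑ i ∈ Finset.range n, Real.ofDigitsTerm (prefixExtend b e) i + 1) /
          (b : ℝ) ^ n) := by
  rintro x ⟨hx, hx01⟩
  have hbpos : (0 : ℝ) < (b : ℝ) ^ n := pow_pos (Nat.cast_pos.mpr (NeZero.pos b)) n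
  -- the prefix sum only depends on the first `n` digits
  have hsum : ∑ i ∈ Finset.range n, Real.ofDigitsTerm (prefixExtend b e) i =
      ∑ i ∈ Finset.range n, Real.ofDigitsTerm (Real.digits x b) i := by
    refine Finset.sum_congr rfl fun i hi => ?_
    have hi' : i < n := Finset.mem_range.mp hi
    have hdig : Real.digits x b i = e ⟨i, hi'⟩ := by
      have := congrFun hx ⟨i, hi'⟩
      simpa [digitPrefix] using this
    simp [Real.ofDigitsTerm, prefixExtend, hi', hdig]
  have hfloor : (b : ℝ) ^ n * ∑ i ∈ Finset.range n, Real.ofDigitsTerm (prefixExtend b e) i =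
      (⌊(b : ℝ) ^ n * x⌋₊ : ℝ) := by
    rw [hsum]
    exact Real.ofDigits_digits_sum_eq ⟨hx01.1, hx01.2⟩ n
  rw [hfloor]
  have h0 : 0 ≤ (b : ℝ) ^ n * x := mul_nonneg hbpos.le hx01.1
  constructor
  · rw [div_le_iff₀ hbpos]
    calc (⌊(b : ℝ) ^ n * x⌋₊ : ℝ) ≤ (b : ℝ) ^ n * x := Nat.floor_le h0
      _ = x * (b : ℝ) ^ n := mul_comm _ _
  · rw [le_div_iff₀ hbpos]
    calc x * (b : ℝ) ^ n = (b : ℝ) ^ n * x := mul_comm _ _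
      _ ≤ (⌊(b : ℝ) ^ n * x⌋₊ : ℝ) + 1 := (Nat.lt_floor_add_one _).le

/-- Hence each digit cylinder of depth `n` has Lebesgue measure at most `b^{-n}`. [folklore] -/
private theorem volume_setOf_digitPrefix_digits_le [NeZero b] {n : ℕ} (e : Fin n → Fin b) :
    volume ({x : ℝ | digitPrefix b n (Real.digits x b) = e} ∩ Ico (0 : ℝ) 1) ≤
      ((b : ℝ≥0∞)⁻¹) ^ n := by
  have hb0 : (0 : ℝ) < b := Nat.cast_pos.mpr (NeZero.pos b)
  have hbpos : (0 : ℝ) < (b : ℝ) ^ n := pow_pos hb0 n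
  refine (measure_mono (setOf_digitPrefix_digits_subset_Icc b e)).trans ?_
  rw [Real.volume_Icc, div_sub_div_same, add_sub_cancel_left, one_div,
    ENNReal.ofReal_inv_of_pos hbpos, ENNReal.ofReal_pow hb0.le, ENNReal.ofReal_natCast,
    ENNReal.inv_pow]

/-- A squeeze on a finite set: if nonnegative masses `m a ≤ c` sum to `|α| c` with `c` finite, every
mass equals `c`. [folklore] -/
private theorem eq_of_le_of_sum_eq_card_mul {α : Type*} [Fintype α] {m : α → ℝ≥0∞} {c : ℝ≥0∞}
    (hc : c ≠ ⊤) (hle : ∀ a, m a ≤ c) (hsum : ∑ a, m a = Fintype.card α * c) (a : α) :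
    m a = c := by
  classical
  refine le_antisymm (hle a) ?_
  have h1 : ∑ x, m x = m a + ∑ x ∈ Finset.univ.erase a, m x :=
    (Finset.add_sum_erase _ _ (Finset.mem_univ a)).symm
  have h2 : ∑ x ∈ Finset.univ.erase a, m x ≤ ((Fintype.card α - 1 : ℕ) : ℝ≥0∞) * c := by
    refine (Finset.sum_le_sum fun x _ => hle x).trans ?_
    rw [Finset.sum_const, Finset.card_erase_of_mem (Finset.mem_univ a), Finset.card_univ,
      nsmul_eq_mul]
  have hcard : (Fintype.card α : ℝ≥0∞) * c = c + ((Fintype.card α - 1 : ℕ) : ℝ≥0∞) * c := by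
    have hpos : 0 < Fintype.card α := Fintype.card_pos_iff.mpr ⟨a⟩
    have : Fintype.card α = (Fintype.card α - 1) + 1 := (Nat.sub_add_cancel hpos).symm
    conv_lhs => rw [this]
    push_cast
    ring
  have h3 : c + ((Fintype.card α - 1 : ℕ) : ℝ≥0∞) * c ≤
      m a + ((Fintype.card α - 1 : ℕ) : ℝ≥0∞) * c := by
    rw [← hcard, ← hsum, h1]
    exact add_le_add le_rfl h2
  have hfin : ((Fintype.card α - 1 : ℕ) : ℝ≥0∞) * c ≠ ⊤ :=
    ENNReal.mul_ne_top (ENNReal.natCast_ne_top _) hc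
  exact (ENNReal.add_le_add_iff_right hfin).mp h3

/-- The law of the first `n` digits of a uniform point of `[0,1)` agrees with the first-`n`-digit
marginal of the product law (both are uniform on the `bⁿ` digit strings). [folklore] -/
private theorem map_digitPrefix_digits_eq [NeZero b] (n : ℕ) :
    (((volume : Measure ℝ).restrict (Ico (0 : ℝ) 1)).map (fun x => Real.digits x b)).map
        (digitPrefix b n) =
      (digitSeqMeasure b).map (digitPrefix b n) := by
  have hmeas : Measurable fun x : ℝ => digitPrefix b n (Real.digits x b) :=
    (measurable_digitPrefix b n).comp (measurable_digits b)
  rw [Measure.map_map (measurable_digitPrefix b n) (measurable_digits b)]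
  have hb0 : (b : ℝ≥0∞) ≠ 0 := Nat.cast_ne_zero.mpr (NeZero.ne b)
  haveI : IsProbabilityMeasure (((volume : Measure ℝ).restrict (Ico (0 : ℝ) 1)).map
      (fun x => digitPrefix b n (Real.digits x b))) :=
    Measure.isProbabilityMeasure_map hmeas.aemeasurable
  -- the left-hand masses are `≤ b^{-n}` …
  have hle : ∀ e : Fin n → Fin b,
      ((volume : Measure ℝ).restrict (Ico (0 : ℝ) 1)).map
        (fun x => digitPrefix b n (Real.digits x b)) {e} ≤ ((b : ℝ≥0∞)⁻¹) ^ n := by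
    intro e
    rw [Measure.map_apply hmeas (measurableSet_singleton e),
      Measure.restrict_apply (hmeas (measurableSet_singleton e))]
    exact volume_setOf_digitPrefix_digits_le b e
  -- … and they sum to one `= bⁿ · b⁻ⁿ`
  have hsum : ∑ e : Fin n → Fin b,
      ((volume : Measure ℝ).restrict (Ico (0 : ℝ) 1)).map
        (fun x => digitPrefix b n (Real.digits x b)) {e} =
      (Fintype.card (Fin n → Fin b) : ℝ≥0∞) * ((b : ℝ≥0∞)⁻¹) ^ n := by
    rw [sum_measure_singleton, Finset.coe_univ, measure_univ, Fintype.card_fun, Fintype.card_fin,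
      Fintype.card_fin]
    push_cast
    rw [← mul_pow, ENNReal.mul_inv_cancel hb0 (ENNReal.natCast_ne_top b), one_pow]
  refine Measure.ext_of_singleton fun e => ?_
  rw [Measure.map_apply (measurable_digitPrefix b n) (measurableSet_singleton e),
    digitSeqMeasure_preimage_digitPrefix]
  exact eq_of_le_of_sum_eq_card_mul (ENNReal.pow_ne_top (ENNReal.inv_ne_top.mpr hb0)) hle hsum e

/-- **The base-`b` digits of a uniformly distributed point of `[0,1)` are independent and uniformly
distributed on `{0, …, b-1}`**: the push-forward of Lebesgue measure on `[0,1)` under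
`x ↦ (ξ_k(x))_k` is the product of the uniform digit laws. [cite: Kallenberg2021, Lemma 3.20] (stated
there for `b = 2`; the base-`b` case is identical). -/
theorem map_digits_restrict_Ico [NeZero b] :
    ((volume : Measure ℝ).restrict (Ico (0 : ℝ) 1)).map (fun x => Real.digits x b) =
      digitSeqMeasure b := by
  refine Measure.eq_infinitePi _ fun s t ht => ?_
  -- all constrained coordinates lie below some `n`
  obtain ⟨n, hn⟩ : ∃ n : ℕ, ∀ i ∈ s, i < n :=
    ⟨s.sup id + 1, fun i hi => Nat.lt_succ_of_le (Finset.le_sup (f := id) hi)⟩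
  let S : Set (Fin n → Fin b) := {g | ∀ i : Fin n, (i : ℕ) ∈ s → g i ∈ t i}
  have hS : Set.pi (↑s) t = digitPrefix b n ⁻¹' S := by
    ext d
    simp only [Set.mem_pi, Finset.mem_coe, mem_preimage, mem_setOf_eq, S, digitPrefix]
    constructor
    · intro h i hi
      exact h i hi
    · intro h i hi
      exact h ⟨i, hn i hi⟩ hi
  have hSm : MeasurableSet S := S.toFinite.measurableSet
  rw [hS, ← Measure.map_apply (measurable_digitPrefix b n) hSm, map_digitPrefix_digits_eq,
    Measure.map_apply (measurable_digitPrefix b n) hSm, ← hS, digitSeqMeasure,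
    Measure.infinitePi_pi _ (fun i _ => ht i)]

/-- Conversely, **`Σ_k ξ_k b^{-k}` is uniformly distributed on `[0,1)` when the digits `ξ_k` are
i.i.d. uniform** (`b ≥ 2`): `Real.ofDigits` pushes the product digit law forward to Lebesgue measure
on `[0,1)`. [cite: Kallenberg2021, Lemma 3.20] (there `b = 2`). -/
theorem map_ofDigits_digitSeqMeasure [NeZero b] (hb : 1 < b) :
    (digitSeqMeasure b).map Real.ofDigits = (volume : Measure ℝ).restrict (Ico (0 : ℝ) 1) := by
  rw [← map_digits_restrict_Ico b,
    Measure.map_map Real.continuous_ofDigits.measurable (measurable_digits b)]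
  have : (Real.ofDigits ∘ fun x => Real.digits x b) =ᵐ[(volume : Measure ℝ).restrict (Ico 0 1)]
      id := by
    filter_upwards [ae_restrict_mem measurableSet_Ico] with x hx
    exact Real.ofDigits_digits hb hx
  rw [Measure.map_congr this, Measure.map_id]

/-! ### Shift invariance on the digit space -/

/-- Translating one digit by a constant (in `ℤ/bℤ`) preserves the uniform digit law. [folklore] -/
private theorem map_add_left_digitMeasure [NeZero b] (c : Fin b) :
    (digitMeasure b).map (c + ·) = digitMeasure b := by
  refine Measure.ext_of_singleton fun a => ?_
  rw [Measure.map_apply (measurable_of_countable _) (measurableSet_singleton a),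
    Set.preimage_add_left_singleton, digitMeasure_singleton, digitMeasure_singleton]

/-- Digit-wise translation `d ↦ e + d` of digit sequences is measurable. [folklore] -/
private theorem measurable_add_left_digitSeq [NeZero b] (e : ℕ → Fin b) :
    Measurable fun d : ℕ → Fin b => e + d :=
  measurable_pi_lambda _ fun i =>
    (measurable_of_countable fun a : Fin b => e i + a).comp (measurable_pi_apply i)

/-- **Shift invariance**: digit-wise translation `d ↦ e + d` (addition in `ℤ/bℤ` in every
coordinate) preserves the product digit law — it is the Haar measure of `(ℤ/bℤ)^ℕ`. [folklore] -/
private theorem map_add_left_digitSeqMeasure [NeZero b] (e : ℕ → Fin b) :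
    (digitSeqMeasure b).map (fun d => e + d) = digitSeqMeasure b := by
  have h := Measure.infinitePi_map_pi (μ := fun _ : ℕ => digitMeasure b)
    (f := fun i (a : Fin b) => e i + a) (fun i => measurable_of_countable _)
  simp_rw [map_add_left_digitMeasure] at h
  have hfun : (fun d : ℕ → Fin b => e + d) = fun d i => e i + d i := rfl
  rw [hfun]
  exact h

/-- The product digit law is invariant under the group `(ℤ/bℤ)^ℕ` acting by translation.
[folklore] -/
instance isAddLeftInvariant_digitSeqMeasure [NeZero b] :
    (digitSeqMeasure b).IsAddLeftInvariant :=
  ⟨map_add_left_digitSeqMeasure b⟩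

/-! ### The digital shift on `[0,1)` -/

/-- The **digital shift** `x ⊕ σ = Σ_k ((ξ_k(x) + ξ_k(σ)) mod b) b^{-k}` of `x` by `σ` in base `b`:
digit-wise addition in `ℤ/bℤ` of the base-`b` expansions (Mathlib's `Real.digits`, the expansions
with infinitely many digits `≠ b - 1`), reassembled by `Real.ofDigits`.
[cite: Lemieux2009, §6.2.2] (pp. 205–206; also [Dick–Pillichshammer 2014, eq. (9.22)]). -/
def digitalShift [NeZero b] (x σ : ℝ) : ℝ :=
  Real.ofDigits (Real.digits x b + Real.digits σ b)

/-- `σ ↦ x ⊕ σ` factors through the digit space: digits, translation by the digits of `x`,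
reassembly. [folklore] -/
private theorem digitalShift_eq_comp [NeZero b] (x : ℝ) :
    digitalShift b x =
      (Real.ofDigits ∘ fun d : ℕ → Fin b => Real.digits x b + d) ∘ fun σ : ℝ => Real.digits σ b :=
  rfl

/-- `σ ↦ x ⊕ σ` is measurable. [folklore] -/
private theorem measurable_digitalShift [NeZero b] (x : ℝ) : Measurable (digitalShift b x) := by
  rw [digitalShift_eq_comp]
  exact (Real.continuous_ofDigits.measurable.comp (measurable_add_left_digitSeq b _)).comp
    (measurable_digits b)

/-- **A random digital shift of any point is uniformly distributed** (`b ≥ 2`): for every `x : ℝ`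
the map `σ ↦ x ⊕ σ` pushes Lebesgue measure on `[0,1)` forward to Lebesgue measure on `[0,1)`.
[cite: Lemieux2009, §6.2.3] (p. 206: the digital shift "ensures that each randomized point is
uniformly distributed over `[0,1)ˢ`"; one coordinate). -/
theorem map_digitalShift_restrict_Ico [NeZero b] (hb : 1 < b) (x : ℝ) :
    ((volume : Measure ℝ).restrict (Ico (0 : ℝ) 1)).map (digitalShift b x) =
      (volume : Measure ℝ).restrict (Ico (0 : ℝ) 1) := by
  rw [digitalShift_eq_comp,
    ← Measure.map_map (Real.continuous_ofDigits.measurable.comp (measurable_add_left_digitSeq b _))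
      (measurable_digits b),
    map_digits_restrict_Ico,
    ← Measure.map_map Real.continuous_ofDigits.measurable (measurable_add_left_digitSeq b _),
    map_add_left_digitSeqMeasure, map_ofDigits_digitSeqMeasure b hb]

/-- The random digital shift `σ ↦ x ⊕ σ`, `σ ~ U[0,1)`, is measure preserving, for every `x`.
[cite: Lemieux2009, §6.2.3] -/
theorem measurePreserving_digitalShift [NeZero b] (hb : 1 < b) (x : ℝ) :
    MeasurePreserving (digitalShift b x) ((volume : Measure ℝ).restrict (Ico (0 : ℝ) 1))
      ((volume : Measure ℝ).restrict (Ico (0 : ℝ) 1)) :=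
  ⟨measurable_digitalShift b x, map_digitalShift_restrict_Ico b hb x⟩

/-- One-dimensional form of "each randomized point is uniformly distributed": for every `x` and every
`f` (a.e. strongly measurable on `[0,1)`), `∫_{[0,1)} f(x ⊕ σ) dσ = ∫_{[0,1)} f`.
[cite: Lemieux2009, §6.2.3] -/
theorem setIntegral_comp_digitalShift [NeZero b] (hb : 1 < b) (x : ℝ) {E : Type*}
    [NormedAddCommGroup E] [NormedSpace ℝ E] {f : ℝ → E}
    (hf : AEStronglyMeasurable f ((volume : Measure ℝ).restrict (Ico (0 : ℝ) 1))) :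
    ∫ σ in Ico (0 : ℝ) 1, f (digitalShift b x σ) = ∫ y in Ico (0 : ℝ) 1, f y := by
  have H := measurePreserving_digitalShift b hb x
  have key := integral_map H.measurable.aemeasurable (f := f) (by rw [H.map_eq]; exact hf)
  rw [H.map_eq] at key
  exact key.symm

/-! ### The digital shift on `[0,1)ˢ` and unbiasedness of digitally shifted rules -/

variable {ι : Type*} [Fintype ι]

/-- The half-open unit cube `[0,1)ˢ = Π_j [0,1)`. [folklore] -/
def unitCubeIco (ι : Type*) : Set (ι → ℝ) := Set.pi univ fun _ => Ico (0 : ℝ) 1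

/-- Lebesgue measure on `[0,1)ˢ` is the product of the Lebesgue measures on `[0,1)`. [folklore] -/
private theorem volume_restrict_unitCubeIco :
    (volume : Measure (ι → ℝ)).restrict (unitCubeIco ι) =
      Measure.pi fun _ : ι => (volume : Measure ℝ).restrict (Ico (0 : ℝ) 1) := by
  rw [unitCubeIco, volume_pi, Measure.restrict_pi_pi]

/-- Lebesgue measure on `[0,1)ˢ` is a probability measure. [folklore] -/
instance isProbabilityMeasure_volume_restrict_unitCubeIco :
    IsProbabilityMeasure ((volume : Measure (ι → ℝ)).restrict (unitCubeIco ι)) := by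
  rw [volume_restrict_unitCubeIco]; infer_instance

/-- The coordinatewise digital shift `x ⊕ σ = (x_j ⊕ σ_j)_j` on `ℝˢ`.
[cite: Lemieux2009, §6.2.2] (also [Dick–Pillichshammer 2014, eq. (9.22)]). -/
def digitalShiftPi [NeZero b] (x σ : ι → ℝ) : ι → ℝ := fun j => digitalShift b (x j) (σ j)

/-- **Each digitally shifted point is uniformly distributed over `[0,1)ˢ`**: for every `x ∈ ℝˢ`,
`σ ↦ x ⊕ σ` preserves Lebesgue measure on `[0,1)ˢ` (`b ≥ 2`). [cite: Lemieux2009, §6.2.3] -/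
theorem measurePreserving_digitalShiftPi [NeZero b] (hb : 1 < b) (x : ι → ℝ) :
    MeasurePreserving (digitalShiftPi b x) ((volume : Measure (ι → ℝ)).restrict (unitCubeIco ι))
      ((volume : Measure (ι → ℝ)).restrict (unitCubeIco ι)) := by
  rw [volume_restrict_unitCubeIco]
  exact measurePreserving_pi _ _ fun j => measurePreserving_digitalShift b hb (x j)

/-- `∫_{[0,1)ˢ} f(x ⊕ σ) dσ = ∫_{[0,1)ˢ} f` for every `x ∈ ℝˢ` and every `f` a.e. strongly measurable on
`[0,1)ˢ` (`b ≥ 2`). [cite: Lemieux2009, §6.2.3] -/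
theorem setIntegral_comp_digitalShiftPi [NeZero b] (hb : 1 < b) (x : ι → ℝ) {E : Type*}
    [NormedAddCommGroup E] [NormedSpace ℝ E] {f : (ι → ℝ) → E}
    (hf : AEStronglyMeasurable f ((volume : Measure (ι → ℝ)).restrict (unitCubeIco ι))) :
    ∫ σ in unitCubeIco ι, f (digitalShiftPi b x σ) = ∫ y in unitCubeIco ι, f y := by
  have H := measurePreserving_digitalShiftPi b hb x
  have key := integral_map H.measurable.aemeasurable (f := f) (by rw [H.map_eq]; exact hf)
  rw [H.map_eq] at key
  exact key.symm

/-- The digitally shifted equal-weight rule `(1/N) Σ_i f(P_i ⊕ σ)` over a finite point family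
`P : κ → ℝˢ`. [cite: Lemieux2009, §6.2.2] -/
def digitalShiftAverage [NeZero b] {κ : Type*} [Fintype κ] {E : Type*} [AddCommMonoid E]
    [Module ℝ E] (P : κ → ι → ℝ) (f : (ι → ℝ) → E) (σ : ι → ℝ) : E :=
  (Fintype.card κ : ℝ)⁻¹ • ∑ i, f (digitalShiftPi b (P i) σ)

/-- **Unbiasedness of the random digital shift**: for every finite nonempty point family `P_1, …, P_N`
(any points — a digital net or not) and every `f` integrable on `[0,1)ˢ`, the digitally shifted rule
has mean `∫_{[0,1)ˢ} f` over a uniform shift `σ ∈ [0,1)ˢ` (`b ≥ 2`):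
`∫_{[0,1)ˢ} (1/N) Σ_i f(P_i ⊕ σ) dσ = ∫_{[0,1)ˢ} f`. [cite: Lemieux2009, §6.2.2] (with §6.2.3, p. 206,
and the estimator `μ̂` of Prop. 6.3). -/
theorem setIntegral_digitalShiftAverage [NeZero b] (hb : 1 < b) {κ : Type*} [Fintype κ]
    [Nonempty κ] (P : κ → ι → ℝ) {E : Type*} [NormedAddCommGroup E] [NormedSpace ℝ E]
    {f : (ι → ℝ) → E} (hf : Integrable f ((volume : Measure (ι → ℝ)).restrict (unitCubeIco ι))) :
    ∫ σ in unitCubeIco ι, digitalShiftAverage b P f σ = ∫ y in unitCubeIco ι, f y := by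
  have hi : ∀ i : κ, Integrable (fun σ => f (digitalShiftPi b (P i) σ))
      ((volume : Measure (ι → ℝ)).restrict (unitCubeIco ι)) := fun i =>
    ((measurePreserving_digitalShiftPi b hb (P i)).integrable_comp hf.aestronglyMeasurable).mpr hf
  simp only [digitalShiftAverage]
  rw [integral_smul, integral_finsetSum _ fun i _ => hi i]
  simp_rw [setIntegral_comp_digitalShiftPi b hb _ hf.aestronglyMeasurable]
  rw [Finset.sum_const, Finset.card_univ, ← Nat.cast_smul_eq_nsmul ℝ,
    inv_smul_smul₀ (Nat.cast_ne_zero.mpr Fintype.card_ne_zero)]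

end Literature.Analysis.Quadrature

end
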